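import Literature.IUT.LogThetaLattice.GlobalPacketsLocalizationModelArchWitness
import HarnessLib

/-!
# [IUTchIII] Proposition 3.3 (ii): the integral structures of the number-field model are PROPER (proofs only)

Proof-only companion of `GlobalPacketsLocalizationModel.lean` (abc-iut cell, seat abc-iut-w4-d037). S. Mochizuki,
*Inter-universal Teichmüller theory III*, kurims manuscript (May 2020), §3, Proposition 3.3 (ii), p. 100
[claim: Mochizuki2012, status: disputed] — the content here is classical.

v2 (de-duplication, 2026-08-26): v1 of this file (p413013) carried its own archimedean witness
`locAt_single_two_not_mem_integralPureTensors`, which abc-iut-w5-d039 had landed minutes earlier under the SAME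
fully-qualified name in `GlobalPacketsLocalizationModelArchWitness.lean` (p412907). The witness of record is
w5-d039's; this file now IMPORTS it and keeps only the two corollaries nothing else states:
`integralPureTensors_none_ne_univ` (the archimedean integral structure of the model is a proper subset) and
`integralPacket_ne_top` (at a prime `p` the integral structure is a proper subring — from the landed finite-place
certificate `locAt_single_inv_prime_not_mem`). Nothing here bears on the disputed [IUTchIII] Cor. 3.12; typed ≠
endorsed.
-/

noncomputable section

namespace Literature.IUT.LogThetaLattice

namespace LocalizationModel

variable (K : Type) [Field K] [NumberField K] (A : Type)

/-- The archimedean integral structure `integralPureTensors K A ∞` of the model is a proper subset of the packet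
(the image of `2 ∈ (†𝕄⊛_mod)_α` lies outside it: abc-iut-w5-d039's `locAt_single_two_not_mem_integralPureTensors`).
**IUTchIII:Prop3.3(ii)** model, non-vacuity. [claim: Mochizuki2012, status: disputed] -/
theorem integralPureTensors_none_ne_univ [Fintype A] [DecidableEq A] [Nonempty A] :
    integralPureTensors K A none ≠ Set.univ := by
  obtain ⟨α⟩ := (inferInstance : Nonempty A)
  intro h
  exact locAt_single_two_not_mem_integralPureTensors K A α (h ▸ Set.mem_univ _)

/-- At a prime `p` the integral structure `integralPacket K A p` of the model is a proper subring (the image of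
`p⁻¹` lies outside it: `locAt_single_inv_prime_not_mem`). **IUTchIII:Prop3.3(ii)** model, non-vacuity.
[claim: Mochizuki2012, status: disputed] -/
theorem integralPacket_ne_top [Fintype A] [DecidableEq A] [Nonempty A] (p : Nat.Primes) :
    integralPacket K A (some p) ≠ ⊤ := by
  obtain ⟨α⟩ := (inferInstance : Nonempty A)
  intro h
  exact locAt_single_inv_prime_not_mem K A p α (h ▸ Subring.mem_top _)

end LocalizationModel

end Literature.IUT.LogThetaLattice

end
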